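import Summits.QuantumFields.BalabanUV.Beta.D1BFx.StraightPinRestRowMass
import Summits.QuantumFields.BalabanUV.Beta.D1BFx.StraightPinMultiplierEnvelope
import Summits.QuantumFields.BalabanUV.Beta.D1BFx.ChartDefectTwoPinsRest

/-!
# `BalabanUV.Beta.D1BFx.ChartDefectRowRestScales` — road «BF-x», binder row D1, PART 24-hyb HEAD ON THE SCALES (the OWNER d1-p2 g25's `ChartDefectHeadScales` p372246:
# «constants `C•` FIXED BEFORE `∀ m`»): **ROW (rest) ON THE SCALES — the pin `hWrest` VERBATIM, the binders `hArest ∧ hBrest` with ONE m-INDEPENDENT CONSTANT,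
# modulo the m-uniform leg letter `hK₀ : ∀ m, Bdd (KInvStep 3 (Lc^m) 0) S₀` and ONE displayed table letter `hMix : ∀ m, symMixAbs ρ_c(Lc^m) (Lc^m) ≤ Cmix·(Lc^m)³`.**
# At every scale `n := Lc^m` the HEAD's pinned (rest) kernel `z₀ ↦ ½·tadpole G₀ (W2SymOfK K₀ n S♭ M⁰ S₂⁰ M₂⁰ a 0 e z₀ − vertex2OfK K₀ n S₂⁰ a 0 e z₀)`
# (`G₀ = coDressKBmAt (ctr 4 n) n K₀`, `K₀ = KInvStep 3 n 0`, the record's tables at `cΛ m`, colour number `N`) has absolutely summable (1.22) second moments and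
# `|secondMoment (Wrest m) μ ν| ≤ C_rest* := (289·S₀·Cmix·(K*·e^{4θ}))·Σ'_x |x|₁² e^{−min (m₀∕8) (θ∕2)|x|₁}`,
# `K* = 16·C₄e^{κ′}·(CΦ·e^{κ₀})·e^{m₀}·e^{m₀}·Zl 4 (m₀∕8)·Zl 4 (θ∕2)`, `CΦ = 2·c166Z 3`, `κ₀ = kappaZ 3`, `m₀ = min κ′ κ₀`, `κ′ = kappa163 4∕4` — NO `m`, NO `Lc`.

HONEST DEPENDENCY (cell records, verbatim): «continuum YM on T⁴ ⇐ BetaPertH ∧ nine spine estimates (0/9 proved); BetaPertH ⇐ (D1) ∧ (D4) ∧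
CAP+tail; G-an2-4 gates asym, D1 and NE2/3/4.»  HONEST FRAMING (cell contract, verbatim): «discharging `BetaPertH` makes Bałaban's UV stability
UNCONDITIONAL — a real constructive-QFT result; it is NOT the continuum limit and NOT the Clay problem.»  THIS MODULE is [folklore] binder-order bookkeeping BY NAME
over LANDED objects: this lineage's g63 «REST-ROW-MASS» `StraightPinRestRowMass.restRow_record_mass` (the (rest) row priced through an1's reference-block total
`symMixAbs`, NET `n⁻¹³ × symMixAbs × S × CΦ` at an n-free coarse rate), g63 «G0-BDD» `RoadPinKernelBdd.bdd_G₀_of_bdd` (the road's dressed leg `Bdd G₀ ((1+16n)²·S₀)`),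
d1-leaf-04 g28's «WPHI-ENVELOPE» `StraightPinMultiplierEnvelope.abs_wΦ_le_hΦ` (the multiplier envelope `hΦ` HYPOTHESIS-FREE with n-free `CΦ = 2·c166Z 3`, `κ₀ = kappaZ 3`),
the OWNER's `ChartDefectTwoPinsRest.tadpole_rest_record_eq` (the literal = the straight mixed pair under `tadpole G₀`) — and real arithmetic
(`(1+16n)² ≤ 289n²`, `n²·n³·n⁻¹³ = n⁻⁸ ≤ 1`).  No `def`, no `def … : Prop`, nothing cited, 0 sorry, default heartbeats.
WHAT IT IS: ONE of the EIGHT displayed rows of `ChartDefectHeadScales` (`hWrest` by `rfl`, `hArest ∕ hBrest` by §3) with its constant bound before `m` — the first of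
an2 R-D1-g48 W-6 (3)'s two uniformities for THIS row (the torus size does not occur: the moment is the `ℤ⁴` sum) — MODULO two displayed m-uniform letters: the straight
one-shot kernel's sup `S₀` (the (K)-wall's; leaf-03 g34's TT33–TT35 convention, the same `S₀` for all rows) and the table law `hMix` (d1-leaf-04 g29's «SYMMIX-MASS» (5∕5)
`SymMixedTableMass.symMixAbs_ctr_le` gives `Cmix = 3·10⁸` at `ctr 4`; it is a displayed HYPOTHESIS here until that file is in the tree — NOT asserted).
WHAT IT IS NOT: the HEAD (seven rows remain: (ins) the OWNER's; (dd) leaf-01 g34; (mcol)(ms)(lamf) leaf-03 g34; (xb)(bb) under an2 W-6 (3) re-pairing); NOT a binder;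
0∕4 row-D1 binders (hW ∕ hR ∕ D1Tel ∕ D1Rep); (K) NOT closed; (J1) ONE OPEN ROW; NOT D1, NEVER «G-an2-4 closed», NOT `BetaPertH`, NOT continuum, NOT Clay.

ABSOLUTE RULE (cell charter, verbatim): «No internally-minted statement may enter as a cited fact. Every hypothesis is either kernel-proved in
this package or a verbatim quotation of a PUBLISHED theorem with page reference. The manuscript(s) under audit are NOT citable for their own
disputed steps — they are the thing under adjudication; programme-internal (2001/route/tribunal) claims are never citable.»

CONTENT.
* §1 [`d = 3`, `[NeZero n]`, every `n`] **`restRow_literal_mass`**: the (rest) row AT THE HEAD's LITERAL (`W2SymOfK − vertex2OfK` under `½·tadpole G₀`) modulo `hK₀ : Bdd K₀ S₀` only —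
  `restRow_record_mass` with `hG := bdd_G₀_of_bdd n hK₀`, `hΦ := abs_wΦ_le_hΦ n`, the word moved by `tadpole_rest_record_eq`; constant = g63's with `S := (1+4((3+1)n))²·S₀`,
  `CΦ := 2·c166Z 3`, `κ₀ := kappaZ 3` substituted (every power of `n` still DISPLAYED).
* §2 [folklore, real arithmetic] `dressFactor_sq_le` (`(1+4((3+1)n))² ≤ 289n²`), `powFactor_le_one` (`n²·n³·((n⁵)⁻¹·((n⁵)⁻¹·(n³)⁻¹)) ≤ 1`), `restMassConst_nonneg`,
  **`restScaleFactor_le`**: for `1 ≤ n`, `0 ≤ S₀`, `0 ≤ K`, `0 ≤ E`, `0 ≤ X ≤ Cmix·n³`: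
  `((1+4((3+1)n))²·S₀)·(2·(((n⁵)⁻¹·((n⁵)⁻¹·(n³)⁻¹))·K)·(X·E)) ≤ (289·S₀·Cmix·(K·E))·2` — the row's only `n`-dependence, bounded before `n`.
* §3 **`restRow_uniform`** (every `n ≥ 1`, constant n-FREE under `hK₀`, `hMix`) and **`row_rest_scales`** (`Lc ≠ 0`; at `n := Lc^m`, `NeZero (Lc^m)` from `NeZero Lc`):
  `(∀ m a e, AbsMoment₂ (Wrest m a e)) ∧ ∀ m, |secondMoment (Wrest m) μ ν| ≤ C_rest*`, `Wrest m` THE LITERAL of `ChartDefectHeadScales`' pin `hWrest` at scale `m`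
  (so the consumer takes `Wrest := fun m a e z₀ ↦ (the literal)`, `hWrest := fun _ _ _ _ ↦ rfl`, `hArest := (row_rest_scales …).1`, `hBrest := (row_rest_scales …).2`, `Crest := C_rest*`).
NOT HERE (honest): the n-law of `S₀` (whether ONE `S₀` bounds `KInvStep 3 (Lc^m) 0` for all `m` is the (K)-wall's ∕ «G0-DECAY»'s question, modulo `hΓ`); the table law
(leaf-04's file); the other seven rows; the HEAD's sum.
Unit `b2b-balaban-gan24-formalise-leaf-05` (gen 64), G-an2-4 swarm leaf prover 05, road «BF-x» supplier, (rest) row lineage g62–g64; INTENT-1 «REST-ROW-SCALES» (journal).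
Not in print; our bookkeeping.  No existing file touched.
-/

noncomputable section

open Finset
open scoped BigOperators
open Literature.MathematicalPhysics.QuantumFieldTheory
open Literature.MathematicalPhysics.QuantumFieldTheory.Balaban1983to89
open Literature.MathematicalPhysics.QuantumFieldTheory.Balaban1983to89.Beta
open B12Sec2to5 (l1 l1_nonneg)
open B12Beta (secondMoment)
open DecimatedMomentSummable (AbsMoment₂)
open B4ContourShift (supNorm)
open B5Hk163Strip (kappa163 kappa163_pos)
open B5Hk163Decay (MG163 MG163_nonneg)
open B4TorusKernel (periodConst)
open B5Kernel166Decay (periodConst_pos)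
open B5Symbol166Strip (MG_pos)
open WilsonVertex2Sym (wsym22)
open WilsonBiStencil (wilsonW₂)
open StepJetData (wilsonA)
open ExpKernelCalculus (Site MKer Zl Zl_nonneg tadpole)
open AffineAveraging (box toSite)
open AveragingContoursRooted (ctr ctrOff ctrOff_mem_box)
open KernelSpecInstance (wΦ)
open KernelWard (Bdd)
open OneStepResolventKernel (Fib)
open OneStepKernelFamily (KInvStep)
open SecondOrderResponse (mixOfK W2SymOfK vertex2OfK)
open BalabanStepW2 (M2Of)
open Summit.QuantumFields.BalabanUV.Beta.SymAveragingHessianCounts (symVhSAt)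
open Summit.QuantumFields.BalabanUV.Beta.SymAveragingMixedJetTables (symMixAbs symMixAbs_nonneg)
open Summit.QuantumFields.BalabanUV.Beta.SymSecondOrderTablesAn1 (symVh₂SAn1 symTablesAn1S2)
open Summit.QuantumFields.BalabanUV.Beta.AxialDressingRooted (coDressKBmAt)
open Summit.QuantumFields.BalabanUV.Beta.GAN24.DirichletExhaustionDeltaZ (c166Z kappaZ kappaZ_pos)
open Summit.QuantumFields.BalabanUV.Beta.D1BFx.RoadPinKernelBdd (bdd_G₀_of_bdd)
open Summit.QuantumFields.BalabanUV.Beta.D1BFx.StraightPinRestRowMass (restRow_record_mass)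
open Summit.QuantumFields.BalabanUV.Beta.D1BFx.StraightPinMultiplierEnvelope (abs_wΦ_le_hΦ kappaZ_three_pos)
open Summit.QuantumFields.BalabanUV.Beta.D1BFx.ChartDefectTwoPinsRest (tadpole_rest_record_eq)

namespace Summit.QuantumFields.BalabanUV.Beta.D1BFx.ChartDefectRowRestScales

/-! ## §1 The (rest) row at the HEAD's literal, every `n`: leg letter `hK₀` only, the multiplier envelope gone -/

section Literal

variable (n : ℕ) [NeZero n]

/-- [our objects + folklore] **«REST-ROW-LITERAL» — THE HEAD's ROW (rest) IN THE SHAPE OF THE PIN `hWrest`, MODULO `hK₀ : Bdd K₀ S₀` ONLY** (`0 ≤ S₀`, colour number `N`,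
Λ-scalar `cΛ`, a free coarse rate `0 < θ`): for `Wrest a e z := ½·tadpole G₀ (W2SymOfK K₀ n S♭ M⁰ S₂⁰ M₂⁰ a 0 e z − vertex2OfK K₀ n S₂⁰ a 0 e z)` (the literal of
`ChartDefectHeadScales`' `hWrest` ∕ `ChartDefectHead`'s (rest) group at block size `n`),
(i) `∀ a e, AbsMoment₂ (Wrest a e)`; (ii) `|secondMoment Wrest μ ν| ≤ ½·(((1+4((3+1)n))²·S₀)·(2·((n⁵)⁻¹·((n⁵)⁻¹·(n³)⁻¹))·K*)·(symMixAbs ρ_c n·e^{4θ})))·Σ'_x |x|₁² e^{−min (m₀∕8) (θ∕2)|x|₁}`,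
`K* = 16·C₄e^{κ′}·((2·c166Z 3)·e^{kappaZ 3})·e^{m₀}·e^{m₀}·Zl 4 (m₀∕8)·Zl 4 (θ∕2)`, `m₀ = min (kappa163 4∕4) (kappaZ 3)`:
g63 `restRow_record_mass` with `hG := bdd_G₀_of_bdd n hK₀` (g63 «G0-BDD»), `hΦ := abs_wΦ_le_hΦ n` (leaf-04 g28, hypothesis-free), and the word rewritten pointwise by the
OWNER's `tadpole_rest_record_eq` (the (D-R) rest under `tadpole G₀` IS the straight mixed pair).  Every power of `n` displayed; nothing of an1's table asserted. -/
theorem restRow_literal_mass {S₀ : ℝ} (hS₀ : 0 ≤ S₀) (hK₀ : Bdd (KInvStep (d := 3) n 0) S₀) (N : ℕ) (cΛ : ℝ) {θ : ℝ} (hθ : 0 < θ)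
    (μ ν : Fin (3 + 1)) :
    (∀ a e : Fin (3 + 1), AbsMoment₂ (fun z : Site 4 => (1 / 2 : ℝ) * tadpole (coDressKBmAt (ctr 4 n) n (KInvStep (d := 3) n 0))
        (W2SymOfK (KInvStep (d := 3) n 0) n (fun κ u => ((n : ℝ) ^ 4) • wilsonA 3 κ u + (-((n : ℝ) ^ 8 / 2)) • symVhSAt (ctr 4 n) 3 n rfl κ u)
              ((symTablesAn1S2 3 n cΛ).M 0) (fun κ u κ' u' => ((n : ℝ) ^ 8) • wilsonW₂ 3 ((8 * (N : ℝ) ^ 2)⁻¹ • wsym22 N) κ u κ' u' + (-((n : ℝ) ^ 12 / 4)) • symVh₂SAn1 3 n κ u κ' u')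
              (M2Of 3 n (symTablesAn1S2 3 n cΛ).mixFF 0) a 0 e z
          - vertex2OfK (KInvStep (d := 3) n 0) n
              (fun κ u κ' u' => ((n : ℝ) ^ 8) • wilsonW₂ 3 ((8 * (N : ℝ) ^ 2)⁻¹ • wsym22 N) κ u κ' u' + (-((n : ℝ) ^ 12 / 4)) • symVh₂SAn1 3 n κ u κ' u') a 0 e z))) ∧
      |secondMoment (fun (a e : Fin (3 + 1)) (z : Site 4) => (1 / 2 : ℝ) * tadpole (coDressKBmAt (ctr 4 n) n (KInvStep (d := 3) n 0))
        (W2SymOfK (KInvStep (d := 3) n 0) n (fun κ u => ((n : ℝ) ^ 4) • wilsonA 3 κ u + (-((n : ℝ) ^ 8 / 2)) • symVhSAt (ctr 4 n) 3 n rfl κ u)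
              ((symTablesAn1S2 3 n cΛ).M 0) (fun κ u κ' u' => ((n : ℝ) ^ 8) • wilsonW₂ 3 ((8 * (N : ℝ) ^ 2)⁻¹ • wsym22 N) κ u κ' u' + (-((n : ℝ) ^ 12 / 4)) • symVh₂SAn1 3 n κ u κ' u')
              (M2Of 3 n (symTablesAn1S2 3 n cΛ).mixFF 0) a 0 e z
          - vertex2OfK (KInvStep (d := 3) n 0) n
              (fun κ u κ' u' => ((n : ℝ) ^ 8) • wilsonW₂ 3 ((8 * (N : ℝ) ^ 2)⁻¹ • wsym22 N) κ u κ' u' + (-((n : ℝ) ^ 12 / 4)) • symVh₂SAn1 3 n κ u κ' u') a 0 e z)) μ ν|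
        ≤ ((1 / 2 : ℝ) * (((1 + 4 * (((3 : ℝ) + 1) * n)) ^ 2 * S₀) * (2 * ((((n : ℝ) ^ 5)⁻¹ * (((n : ℝ) ^ 5)⁻¹ * ((n : ℝ) ^ 3)⁻¹))
            * (16 * ((MG163 4 * periodConst (kappa163 4) 3) * Real.exp (kappa163 4 / 4)) * ((2 * c166Z 3) * Real.exp (kappaZ 3))
                * Real.exp (min (kappa163 4 / 4) (kappaZ 3)) * Real.exp (min (kappa163 4 / 4) (kappaZ 3))
                * Zl 4 (min (kappa163 4 / 4) (kappaZ 3) / 8) * Zl 4 (θ / 2)))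
            * (symMixAbs (ctr 4 n) n * Real.exp (θ * ((3 : ℝ) + 1))))))
          * ∑' x : Site 4, l1 x ^ 2 * Real.exp (-(min (min (kappa163 4 / 4) (kappaZ 3) / 8) (θ / 2)) * l1 x) := by
  have hG := bdd_G₀_of_bdd n hK₀
  have hS : (0 : ℝ) ≤ (1 + 4 * (((3 : ℝ) + 1) * n)) ^ 2 * S₀ := by positivity
  have h := restRow_record_mass n hG hS kappaZ_three_pos (abs_wΦ_le_hΦ n) cΛ hθ μ ν
  have hw : ∀ (a e : Fin (3 + 1)) (z : Site 4),
      (1 / 2 : ℝ) * tadpole (coDressKBmAt (ctr 4 n) n (KInvStep (d := 3) n 0))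
        (W2SymOfK (KInvStep (d := 3) n 0) n (fun κ u => ((n : ℝ) ^ 4) • wilsonA 3 κ u + (-((n : ℝ) ^ 8 / 2)) • symVhSAt (ctr 4 n) 3 n rfl κ u)
              ((symTablesAn1S2 3 n cΛ).M 0) (fun κ u κ' u' => ((n : ℝ) ^ 8) • wilsonW₂ 3 ((8 * (N : ℝ) ^ 2)⁻¹ • wsym22 N) κ u κ' u' + (-((n : ℝ) ^ 12 / 4)) • symVh₂SAn1 3 n κ u κ' u')
              (M2Of 3 n (symTablesAn1S2 3 n cΛ).mixFF 0) a 0 e z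
          - vertex2OfK (KInvStep (d := 3) n 0) n
              (fun κ u κ' u' => ((n : ℝ) ^ 8) • wilsonW₂ 3 ((8 * (N : ℝ) ^ 2)⁻¹ • wsym22 N) κ u κ' u' + (-((n : ℝ) ^ 12 / 4)) • symVh₂SAn1 3 n κ u κ' u') a 0 e z)
      = (1 / 2 : ℝ) * tadpole (coDressKBmAt (ctr 4 n) n (KInvStep (d := 3) n 0))
        (mixOfK (KInvStep (d := 3) n 0) n (M2Of 3 n (symTablesAn1S2 3 n cΛ).mixFF 0) a 0 e z
          + mixOfK (KInvStep (d := 3) n 0) n (M2Of 3 n (symTablesAn1S2 3 n cΛ).mixFF 0) e z a 0) := fun a e z => by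
    rw [tadpole_rest_record_eq N cΛ a 0 e z]
  refine ⟨fun a e => ?_, ?_⟩
  · have ef : (fun z : Site 4 => (1 / 2 : ℝ) * tadpole (coDressKBmAt (ctr 4 n) n (KInvStep (d := 3) n 0))
        (W2SymOfK (KInvStep (d := 3) n 0) n (fun κ u => ((n : ℝ) ^ 4) • wilsonA 3 κ u + (-((n : ℝ) ^ 8 / 2)) • symVhSAt (ctr 4 n) 3 n rfl κ u)
              ((symTablesAn1S2 3 n cΛ).M 0) (fun κ u κ' u' => ((n : ℝ) ^ 8) • wilsonW₂ 3 ((8 * (N : ℝ) ^ 2)⁻¹ • wsym22 N) κ u κ' u' + (-((n : ℝ) ^ 12 / 4)) • symVh₂SAn1 3 n κ u κ' u')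
              (M2Of 3 n (symTablesAn1S2 3 n cΛ).mixFF 0) a 0 e z
          - vertex2OfK (KInvStep (d := 3) n 0) n
              (fun κ u κ' u' => ((n : ℝ) ^ 8) • wilsonW₂ 3 ((8 * (N : ℝ) ^ 2)⁻¹ • wsym22 N) κ u κ' u' + (-((n : ℝ) ^ 12 / 4)) • symVh₂SAn1 3 n κ u κ' u') a 0 e z))
      = (fun z : Site 4 => (1 / 2 : ℝ) * tadpole (coDressKBmAt (ctr 4 n) n (KInvStep (d := 3) n 0))
        (mixOfK (KInvStep (d := 3) n 0) n (M2Of 3 n (symTablesAn1S2 3 n cΛ).mixFF 0) a 0 e z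
          + mixOfK (KInvStep (d := 3) n 0) n (M2Of 3 n (symTablesAn1S2 3 n cΛ).mixFF 0) e z a 0)) := funext (hw a e)
    rw [ef]
    exact h.1 a e
  · have ef : (fun (a e : Fin (3 + 1)) (z : Site 4) => (1 / 2 : ℝ) * tadpole (coDressKBmAt (ctr 4 n) n (KInvStep (d := 3) n 0))
        (W2SymOfK (KInvStep (d := 3) n 0) n (fun κ u => ((n : ℝ) ^ 4) • wilsonA 3 κ u + (-((n : ℝ) ^ 8 / 2)) • symVhSAt (ctr 4 n) 3 n rfl κ u)
              ((symTablesAn1S2 3 n cΛ).M 0) (fun κ u κ' u' => ((n : ℝ) ^ 8) • wilsonW₂ 3 ((8 * (N : ℝ) ^ 2)⁻¹ • wsym22 N) κ u κ' u' + (-((n : ℝ) ^ 12 / 4)) • symVh₂SAn1 3 n κ u κ' u')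
              (M2Of 3 n (symTablesAn1S2 3 n cΛ).mixFF 0) a 0 e z
          - vertex2OfK (KInvStep (d := 3) n 0) n
              (fun κ u κ' u' => ((n : ℝ) ^ 8) • wilsonW₂ 3 ((8 * (N : ℝ) ^ 2)⁻¹ • wsym22 N) κ u κ' u' + (-((n : ℝ) ^ 12 / 4)) • symVh₂SAn1 3 n κ u κ' u') a 0 e z))
      = (fun (a e : Fin (3 + 1)) (z : Site 4) => (1 / 2 : ℝ) * tadpole (coDressKBmAt (ctr 4 n) n (KInvStep (d := 3) n 0))
        (mixOfK (KInvStep (d := 3) n 0) n (M2Of 3 n (symTablesAn1S2 3 n cΛ).mixFF 0) a 0 e z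
          + mixOfK (KInvStep (d := 3) n 0) n (M2Of 3 n (symTablesAn1S2 3 n cΛ).mixFF 0) e z a 0)) :=
      funext fun a => funext fun e => funext (hw a e)
    rw [ef]
    exact h.2

end Literal

/-! ## §2 The row's `n`-dependence bounded before `n` (real arithmetic) -/

/-- [folklore] `(1 + 4((3+1)n))² ≤ 289·n²` for `1 ≤ n` (`1 + 16n ≤ 17n`). -/
theorem dressFactor_sq_le {n : ℕ} (hn : 1 ≤ n) : (1 + 4 * (((3 : ℝ) + 1) * n)) ^ 2 ≤ 289 * (n : ℝ) ^ 2 := by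
  have hn' : (1 : ℝ) ≤ n := by exact_mod_cast hn
  have h0 : (0 : ℝ) ≤ 1 + 4 * (((3 : ℝ) + 1) * n) := by positivity
  have h1 : 1 + 4 * (((3 : ℝ) + 1) * n) ≤ 17 * n := by linarith
  calc (1 + 4 * (((3 : ℝ) + 1) * n)) ^ 2 ≤ (17 * (n : ℝ)) ^ 2 := pow_le_pow_left₀ h0 h1 2
    _ = 289 * (n : ℝ) ^ 2 := by ring

/-- [folklore] `n²·n³·((n⁵)⁻¹·((n⁵)⁻¹·(n³)⁻¹)) = (n⁸)⁻¹ ≤ 1` for `1 ≤ n`. -/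
theorem powFactor_le_one {n : ℕ} (hn : 1 ≤ n) :
    (n : ℝ) ^ 2 * (n : ℝ) ^ 3 * (((n : ℝ) ^ 5)⁻¹ * (((n : ℝ) ^ 5)⁻¹ * ((n : ℝ) ^ 3)⁻¹)) ≤ 1 := by
  have hn' : (1 : ℝ) ≤ n := by exact_mod_cast hn
  have hn0 : (n : ℝ) ≠ 0 := by positivity
  have e : (n : ℝ) ^ 2 * (n : ℝ) ^ 3 * (((n : ℝ) ^ 5)⁻¹ * (((n : ℝ) ^ 5)⁻¹ * ((n : ℝ) ^ 3)⁻¹)) = ((n : ℝ) ^ 8)⁻¹ := by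
    field_simp
  rw [e]
  exact inv_le_one_of_one_le₀ (one_le_pow₀ hn')

/-- [folklore] **THE (rest) ROW's SCALE FACTOR BOUNDED BEFORE `n`**: for `1 ≤ n`, `0 ≤ S₀`, `0 ≤ K`, `0 ≤ E`, `0 ≤ X ≤ Cmix·n³`,
`((1+4((3+1)n))²·S₀)·(2·(((n⁵)⁻¹·((n⁵)⁻¹·(n³)⁻¹))·K)·(X·E)) ≤ (289·S₀·Cmix·(K·E))·2` — dressing `(1+16n)² ≤ 289n²`, table `X ≤ Cmix·n³`, the remaining `n⁻⁸ ≤ 1`. -/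
theorem restScaleFactor_le {n : ℕ} (hn : 1 ≤ n) {S₀ K E X Cmix : ℝ} (hS₀ : 0 ≤ S₀) (hK : 0 ≤ K) (hE : 0 ≤ E) (hX : 0 ≤ X)
    (hXle : X ≤ Cmix * (n : ℝ) ^ 3) :
    ((1 + 4 * (((3 : ℝ) + 1) * n)) ^ 2 * S₀) * (2 * ((((n : ℝ) ^ 5)⁻¹ * (((n : ℝ) ^ 5)⁻¹ * ((n : ℝ) ^ 3)⁻¹)) * K) * (X * E))
      ≤ (289 * S₀ * Cmix * (K * E)) * 2 := by
  have hn' : (1 : ℝ) ≤ n := by exact_mod_cast hn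
  have hCmixn : 0 ≤ Cmix * (n : ℝ) ^ 3 := hX.trans hXle
  have hC : 0 ≤ Cmix := nonneg_of_mul_nonneg_left hCmixn (by positivity)
  have h1 : ((1 + 4 * (((3 : ℝ) + 1) * n)) ^ 2 * S₀) * (2 * ((((n : ℝ) ^ 5)⁻¹ * (((n : ℝ) ^ 5)⁻¹ * ((n : ℝ) ^ 3)⁻¹)) * K) * (X * E))
      ≤ ((289 * (n : ℝ) ^ 2) * S₀) * (2 * ((((n : ℝ) ^ 5)⁻¹ * (((n : ℝ) ^ 5)⁻¹ * ((n : ℝ) ^ 3)⁻¹)) * K) * ((Cmix * (n : ℝ) ^ 3) * E)) := by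
    gcongr
    exact dressFactor_sq_le hn
  have h2 : ((289 * (n : ℝ) ^ 2) * S₀) * (2 * ((((n : ℝ) ^ 5)⁻¹ * (((n : ℝ) ^ 5)⁻¹ * ((n : ℝ) ^ 3)⁻¹)) * K) * ((Cmix * (n : ℝ) ^ 3) * E))
      = ((289 * S₀ * Cmix * (K * E)) * 2) * ((n : ℝ) ^ 2 * (n : ℝ) ^ 3 * (((n : ℝ) ^ 5)⁻¹ * (((n : ℝ) ^ 5)⁻¹ * ((n : ℝ) ^ 3)⁻¹))) := by
    ring
  have h3 : 0 ≤ (289 * S₀ * Cmix * (K * E)) * 2 := by positivity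
  calc _ ≤ _ := h1
    _ = _ := h2
    _ ≤ ((289 * S₀ * Cmix * (K * E)) * 2) * 1 := mul_le_mul_of_nonneg_left (powFactor_le_one hn) h3
    _ = (289 * S₀ * Cmix * (K * E)) * 2 := mul_one _

/-- [folklore] The n-free mass constant `K*(θ) = 16·C₄e^{κ′}·((2·c166Z 3)·e^{kappaZ 3})·e^{m₀}·e^{m₀}·Zl 4 (m₀∕8)·Zl 4 (θ∕2)` is nonnegative (`0 < θ`). -/
theorem restMassConst_nonneg {θ : ℝ} (hθ : 0 < θ) :
    (0 : ℝ) ≤ 16 * ((MG163 4 * periodConst (kappa163 4) 3) * Real.exp (kappa163 4 / 4)) * ((2 * c166Z 3) * Real.exp (kappaZ 3))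
      * Real.exp (min (kappa163 4 / 4) (kappaZ 3)) * Real.exp (min (kappa163 4 / 4) (kappaZ 3))
      * Zl 4 (min (kappa163 4 / 4) (kappaZ 3) / 8) * Zl 4 (θ / 2) := by
  have h1 : 0 ≤ MG163 4 := MG163_nonneg 4
  have h2 : 0 ≤ periodConst (kappa163 4) 3 := (periodConst_pos (kappa163_pos 4) 3).le
  have h3 : 0 ≤ c166Z 3 := by unfold c166Z; have := MG_pos (3 + 1); positivity
  have hm : 0 < min (kappa163 4 / 4) (kappaZ 3) / 8 := by
    have := kappa163_pos 4; have := kappaZ_pos 3; positivity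
  have h4 : 0 ≤ Zl 4 (min (kappa163 4 / 4) (kappaZ 3) / 8) := Zl_nonneg hm
  have h5 : 0 ≤ Zl 4 (θ / 2) := Zl_nonneg (by positivity)
  positivity

/-! ## §3 The (rest) row with an n-FREE constant, and ON THE SCALES `n := Lc^m` -/

section Uniform

variable (n : ℕ) [NeZero n]

/-- [our objects + folklore] **«REST-ROW-UNIFORM» — THE (rest) ROW AT THE LITERAL WITH A CONSTANT FREE OF `n`** (modulo `hK₀ : Bdd K₀ S₀`, `0 ≤ S₀`, and the table letter
`hMix : symMixAbs ρ_c n ≤ Cmix·n³`; colour number `N`, `cΛ`, `0 < θ` free): (i) as §1; (ii)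
`|secondMoment Wrest μ ν| ≤ (289·S₀·Cmix·(K*·e^{4θ}))·Σ'_x |x|₁² e^{−min (m₀∕8) (θ∕2)|x|₁}` — §1 then §2 `restScaleFactor_le`.  The right-hand side does not mention `n`. -/
theorem restRow_uniform {S₀ : ℝ} (hS₀ : 0 ≤ S₀) (hK₀ : Bdd (KInvStep (d := 3) n 0) S₀) {Cmix : ℝ} (hMix : symMixAbs (ctr 4 n) n ≤ Cmix * (n : ℝ) ^ 3)
    (N : ℕ) (cΛ : ℝ) {θ : ℝ} (hθ : 0 < θ) (μ ν : Fin (3 + 1)) :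
    (∀ a e : Fin (3 + 1), AbsMoment₂ (fun z : Site 4 => (1 / 2 : ℝ) * tadpole (coDressKBmAt (ctr 4 n) n (KInvStep (d := 3) n 0))
        (W2SymOfK (KInvStep (d := 3) n 0) n (fun κ u => ((n : ℝ) ^ 4) • wilsonA 3 κ u + (-((n : ℝ) ^ 8 / 2)) • symVhSAt (ctr 4 n) 3 n rfl κ u)
              ((symTablesAn1S2 3 n cΛ).M 0) (fun κ u κ' u' => ((n : ℝ) ^ 8) • wilsonW₂ 3 ((8 * (N : ℝ) ^ 2)⁻¹ • wsym22 N) κ u κ' u' + (-((n : ℝ) ^ 12 / 4)) • symVh₂SAn1 3 n κ u κ' u')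
              (M2Of 3 n (symTablesAn1S2 3 n cΛ).mixFF 0) a 0 e z
          - vertex2OfK (KInvStep (d := 3) n 0) n
              (fun κ u κ' u' => ((n : ℝ) ^ 8) • wilsonW₂ 3 ((8 * (N : ℝ) ^ 2)⁻¹ • wsym22 N) κ u κ' u' + (-((n : ℝ) ^ 12 / 4)) • symVh₂SAn1 3 n κ u κ' u') a 0 e z))) ∧
      |secondMoment (fun (a e : Fin (3 + 1)) (z : Site 4) => (1 / 2 : ℝ) * tadpole (coDressKBmAt (ctr 4 n) n (KInvStep (d := 3) n 0))
        (W2SymOfK (KInvStep (d := 3) n 0) n (fun κ u => ((n : ℝ) ^ 4) • wilsonA 3 κ u + (-((n : ℝ) ^ 8 / 2)) • symVhSAt (ctr 4 n) 3 n rfl κ u)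
              ((symTablesAn1S2 3 n cΛ).M 0) (fun κ u κ' u' => ((n : ℝ) ^ 8) • wilsonW₂ 3 ((8 * (N : ℝ) ^ 2)⁻¹ • wsym22 N) κ u κ' u' + (-((n : ℝ) ^ 12 / 4)) • symVh₂SAn1 3 n κ u κ' u')
              (M2Of 3 n (symTablesAn1S2 3 n cΛ).mixFF 0) a 0 e z
          - vertex2OfK (KInvStep (d := 3) n 0) n
              (fun κ u κ' u' => ((n : ℝ) ^ 8) • wilsonW₂ 3 ((8 * (N : ℝ) ^ 2)⁻¹ • wsym22 N) κ u κ' u' + (-((n : ℝ) ^ 12 / 4)) • symVh₂SAn1 3 n κ u κ' u') a 0 e z)) μ ν|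
        ≤ (289 * S₀ * Cmix
            * ((16 * ((MG163 4 * periodConst (kappa163 4) 3) * Real.exp (kappa163 4 / 4)) * ((2 * c166Z 3) * Real.exp (kappaZ 3))
                * Real.exp (min (kappa163 4 / 4) (kappaZ 3)) * Real.exp (min (kappa163 4 / 4) (kappaZ 3))
                * Zl 4 (min (kappa163 4 / 4) (kappaZ 3) / 8) * Zl 4 (θ / 2))
              * Real.exp (θ * ((3 : ℝ) + 1))))
          * ∑' x : Site 4, l1 x ^ 2 * Real.exp (-(min (min (kappa163 4 / 4) (kappaZ 3) / 8) (θ / 2)) * l1 x) := by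
  have h := restRow_literal_mass n hS₀ hK₀ N cΛ hθ μ ν
  refine ⟨h.1, h.2.trans ?_⟩
  have hn : 1 ≤ n := Nat.one_le_iff_ne_zero.2 (NeZero.ne n)
  have hK := restMassConst_nonneg hθ
  have hM : (0 : ℝ) ≤ ∑' x : Site 4, l1 x ^ 2 * Real.exp (-(min (min (kappa163 4 / 4) (kappaZ 3) / 8) (θ / 2)) * l1 x) :=
    tsum_nonneg fun x => by positivity
  have hf := restScaleFactor_le hn hS₀ hK (Real.exp_pos (θ * ((3 : ℝ) + 1))).le (symMixAbs_nonneg (ctr 4 n) n) hMix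
  calc (1 / 2 : ℝ) * (((1 + 4 * (((3 : ℝ) + 1) * n)) ^ 2 * S₀) * (2 * ((((n : ℝ) ^ 5)⁻¹ * (((n : ℝ) ^ 5)⁻¹ * ((n : ℝ) ^ 3)⁻¹))
            * (16 * ((MG163 4 * periodConst (kappa163 4) 3) * Real.exp (kappa163 4 / 4)) * ((2 * c166Z 3) * Real.exp (kappaZ 3))
                * Real.exp (min (kappa163 4 / 4) (kappaZ 3)) * Real.exp (min (kappa163 4 / 4) (kappaZ 3))
                * Zl 4 (min (kappa163 4 / 4) (kappaZ 3) / 8) * Zl 4 (θ / 2)))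
            * (symMixAbs (ctr 4 n) n * Real.exp (θ * ((3 : ℝ) + 1)))))
          * ∑' x : Site 4, l1 x ^ 2 * Real.exp (-(min (min (kappa163 4 / 4) (kappaZ 3) / 8) (θ / 2)) * l1 x)
      ≤ ((1 / 2 : ℝ) * ((289 * S₀ * Cmix * ((16 * ((MG163 4 * periodConst (kappa163 4) 3) * Real.exp (kappa163 4 / 4)) * ((2 * c166Z 3) * Real.exp (kappaZ 3))
                * Real.exp (min (kappa163 4 / 4) (kappaZ 3)) * Real.exp (min (kappa163 4 / 4) (kappaZ 3))
                * Zl 4 (min (kappa163 4 / 4) (kappaZ 3) / 8) * Zl 4 (θ / 2)) * Real.exp (θ * ((3 : ℝ) + 1)))) * 2))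
          * ∑' x : Site 4, l1 x ^ 2 * Real.exp (-(min (min (kappa163 4 / 4) (kappaZ 3) / 8) (θ / 2)) * l1 x) := by
        gcongr
    _ = _ := by ring

end Uniform

/-- **ROW (rest) ON THE SCALES — THE `ChartDefectHeadScales` BINDERS `hArest` ∧ `hBrest` WITH `Crest` BOUND BEFORE `m`** [our objects + folklore] (modulo the m-uniform
leg letter `hK₀ : ∀ m, Bdd (KInvStep 3 (Lc^m) 0) S₀` (`0 ≤ S₀`; the same letter as leaf-03 g34's TT33–TT35) and the m-uniform table letter
`hMix : ∀ m, symMixAbs ρ_c(Lc^m) (Lc^m) ≤ Cmix·(Lc^m)³` (leaf-04 g29's «SYMMIX-MASS» (5∕5) gives `Cmix = 3·10⁸`; displayed here); `N`, `cΛ : ℕ → ℝ`, `0 < θ` free):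
(i) `∀ m a e, AbsMoment₂ (z₀ ↦ ½·tadpole G₀ (W2SymOfK K₀ (Lc^m) S♭ M⁰ S₂⁰ M₂⁰ a 0 e z₀ − vertex2OfK K₀ (Lc^m) S₂⁰ a 0 e z₀))`;
(ii) `∀ m, |secondMoment (a e z₀ ↦ …) μ ν| ≤ (289·S₀·Cmix·(K*·e^{4θ}))·Σ'_x |x|₁² e^{−min (m₀∕8) (θ∕2)|x|₁}` — the right-hand side mentions neither `m` nor `Lc`.
The kernel is `ChartDefectHeadScales.abs_secondMoment_chartDefect_scales_le_of_rows`' pin `hWrest` VERBATIM (take `Wrest := fun m a e z₀ ↦` this literal, `hWrest := fun _ _ _ _ ↦ rfl`,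
`hArest := (row_rest_scales …).1`, `hBrest := (row_rest_scales …).2`).  ONE APPLICATION of `restRow_uniform` per scale (`NeZero (Lc^m)` from `NeZero Lc`).
One of eight rows; NOT the HEAD, NOT a binder; asserts NO n-law of `S₀` and takes the table's as the letter `hMix`. -/
theorem row_rest_scales {Lc : ℕ} [NeZero Lc] (N : ℕ) (cΛ : ℕ → ℝ) {S₀ : ℝ} (hS₀ : 0 ≤ S₀) (hK₀ : ∀ m : ℕ, Bdd (KInvStep (d := 3) (Lc ^ m) 0) S₀)
    {Cmix : ℝ} (hMix : ∀ m : ℕ, symMixAbs (ctr 4 (Lc ^ m)) (Lc ^ m) ≤ Cmix * ((Lc ^ m : ℕ) : ℝ) ^ 3) {θ : ℝ} (hθ : 0 < θ) (μ ν : Fin 4) :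
    (∀ (m : ℕ) (a e : Fin 4), AbsMoment₂ (fun z₀ : Site 4 => (1 / 2 : ℝ) * tadpole (coDressKBmAt (ctr 4 (Lc ^ m)) (Lc ^ m) (KInvStep (d := 3) (Lc ^ m) 0))
        (W2SymOfK (KInvStep (d := 3) (Lc ^ m) 0) (Lc ^ m) (fun κ u => (((Lc ^ m : ℕ) : ℝ) ^ 4) • wilsonA 3 κ u + (-(((Lc ^ m : ℕ) : ℝ) ^ 8 / 2)) • symVhSAt (ctr 4 (Lc ^ m)) 3 (Lc ^ m) rfl κ u)
              ((symTablesAn1S2 3 (Lc ^ m) (cΛ m)).M 0) (fun κ u κ' u' => (((Lc ^ m : ℕ) : ℝ) ^ 8) • wilsonW₂ 3 ((8 * (N : ℝ) ^ 2)⁻¹ • wsym22 N) κ u κ' u' + (-(((Lc ^ m : ℕ) : ℝ) ^ 12 / 4)) • symVh₂SAn1 3 (Lc ^ m) κ u κ' u')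
              (M2Of 3 (Lc ^ m) (symTablesAn1S2 3 (Lc ^ m) (cΛ m)).mixFF 0) a 0 e z₀
          - vertex2OfK (KInvStep (d := 3) (Lc ^ m) 0) (Lc ^ m)
              (fun κ u κ' u' => (((Lc ^ m : ℕ) : ℝ) ^ 8) • wilsonW₂ 3 ((8 * (N : ℝ) ^ 2)⁻¹ • wsym22 N) κ u κ' u' + (-(((Lc ^ m : ℕ) : ℝ) ^ 12 / 4)) • symVh₂SAn1 3 (Lc ^ m) κ u κ' u') a 0 e z₀))) ∧
      ∀ m : ℕ, |secondMoment (fun (a e : Fin 4) (z₀ : Site 4) => (1 / 2 : ℝ) * tadpole (coDressKBmAt (ctr 4 (Lc ^ m)) (Lc ^ m) (KInvStep (d := 3) (Lc ^ m) 0))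
        (W2SymOfK (KInvStep (d := 3) (Lc ^ m) 0) (Lc ^ m) (fun κ u => (((Lc ^ m : ℕ) : ℝ) ^ 4) • wilsonA 3 κ u + (-(((Lc ^ m : ℕ) : ℝ) ^ 8 / 2)) • symVhSAt (ctr 4 (Lc ^ m)) 3 (Lc ^ m) rfl κ u)
              ((symTablesAn1S2 3 (Lc ^ m) (cΛ m)).M 0) (fun κ u κ' u' => (((Lc ^ m : ℕ) : ℝ) ^ 8) • wilsonW₂ 3 ((8 * (N : ℝ) ^ 2)⁻¹ • wsym22 N) κ u κ' u' + (-(((Lc ^ m : ℕ) : ℝ) ^ 12 / 4)) • symVh₂SAn1 3 (Lc ^ m) κ u κ' u')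
              (M2Of 3 (Lc ^ m) (symTablesAn1S2 3 (Lc ^ m) (cΛ m)).mixFF 0) a 0 e z₀
          - vertex2OfK (KInvStep (d := 3) (Lc ^ m) 0) (Lc ^ m)
              (fun κ u κ' u' => (((Lc ^ m : ℕ) : ℝ) ^ 8) • wilsonW₂ 3 ((8 * (N : ℝ) ^ 2)⁻¹ • wsym22 N) κ u κ' u' + (-(((Lc ^ m : ℕ) : ℝ) ^ 12 / 4)) • symVh₂SAn1 3 (Lc ^ m) κ u κ' u') a 0 e z₀)) μ ν|
        ≤ (289 * S₀ * Cmix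
            * ((16 * ((MG163 4 * periodConst (kappa163 4) 3) * Real.exp (kappa163 4 / 4)) * ((2 * c166Z 3) * Real.exp (kappaZ 3))
                * Real.exp (min (kappa163 4 / 4) (kappaZ 3)) * Real.exp (min (kappa163 4 / 4) (kappaZ 3))
                * Zl 4 (min (kappa163 4 / 4) (kappaZ 3) / 8) * Zl 4 (θ / 2))
              * Real.exp (θ * ((3 : ℝ) + 1))))
          * ∑' x : Site 4, l1 x ^ 2 * Real.exp (-(min (min (kappa163 4 / 4) (kappaZ 3) / 8) (θ / 2)) * l1 x) :=
  ⟨fun m a e => (restRow_uniform (Lc ^ m) hS₀ (hK₀ m) (hMix m) N (cΛ m) hθ μ ν).1 a e,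
    fun m => (restRow_uniform (Lc ^ m) hS₀ (hK₀ m) (hMix m) N (cΛ m) hθ μ ν).2⟩

end Summit.QuantumFields.BalabanUV.Beta.D1BFx.ChartDefectRowRestScales

end
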